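import Mathlib.NumberTheory.Padics.HeightOneSpectrum
import Literature.NumberTheory.DiophantineGeometry.Conductor
import Literature.NumberTheory.EllipticCurves.GlobalMinimalModel
import Literature.NumberTheory.EllipticCurves.ModularCurve
import Literature.NumberTheory.EllipticCurves.Rank1Residual.Typed.X3
import Literature.NumberTheory.EllipticCurves.Rank1Residual.Typed.X4
import Literature.NumberTheory.EllipticCurves.Rank1Residual.Typed.KolyvaginCertificate
import HarnessLib
import HarnessLib.Audit.Tags

/-!
# The sharpened conjectures X3♯ / X4♯ of the additive residual classes — STATEMENTS (cell `b2b-bsdres`, seat additive-p4)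

HONEST FRAMING (cell `b2b-bsdres`, run/shared/lean/b2b/bsd-rank1-residual/, verbatim in every
file): the goal of the cell is to DELETE the COMBINATION-SHAPED residual classes of the
Birch–Swinnerton-Dyer formula for ALL analytic-rank `≤ 1` elliptic curves over `ℚ` — "full BSD
formula for every rank `≤ 1` curve in class `C`" assembled STRICTLY from published theorems — so
that the rank-`≤ 1` remainder becomes exactly the CONSTRUCTION-SHAPED classes, which are TYPED
(missing-input `Prop`s), NOT attempted. This is not "finishing BSD". The present sub-cell
(prover seats `additive-p1 … p4`, human GO 2026-08-19T21:53Z) is a RESEARCH ROUTE on the two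
construction-shaped ADDITIVE classes X3 (Eisenstein additive) and X4 (additive, irreducible):
no claim beyond the stated classes; nothing in this file is asserted.

This file states, as `def … : Prop` (never as theorems), the DATA-SUGGESTED sharpened conjectures
of the hypothesis seat's `SHARPENED-CONJECTURES.md` v3.2 (unit `b2b-bsdres-hyp`, 2026-08-19), §3
(X3♯ with its four census sub-statements (M) / (G-ord) / (t′) / (w)) and §4 (X4♯(3), X4♯(unit-free),
X4♯(r = 1)), in the cell's currency: the class predicates `ClassX3 W p := Red W p ∧ Addv W p`,
`ClassX4 W p := p ≠ 2 ∧ Addv W p ∧ Irr W p` of `Rank1Residual/Predicates.lean` (the EXACT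
predicates of bsdN/HYPOTHESES.md) and the typed output `Typed.MissingPPartAt W p`
(`ord_p #Ш(E/ℚ)_an = ord_p #Ш(E/ℚ)`, Miller's last clause) of `Rank1Residual/Typed/Basic.lean`.
They are NOT Literature statements (no source proves them; `lean/Literature/` holds only
published results), hence live here under `Summits/BirchSwinnertonDyer/Rank1Residual/`.

Contents.
* §1 The census sub-types of an additive prime, transcribed from SHARPENED §3 "Core structure"
  (engine A's ELEMENTARY bits, two-engine against Tate's algorithm on all 2392 X3 pairs):
  `PotMult` (`v_p(j) < 0`, potentially multiplicative), `CondExpTwo` (`f_p = 2`, "tame" in the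
  census sense), `semistabilityIndex` (`e = 12 / gcd(12, v_p(Δ_min))`), and the four cells
  `SubM` / `SubGord` / `SubTprime` / `SubW`, with the propositional lemma that they PARTITION every
  pair (`sub_exhaustive`, `subM_disjoint_…`): the human's question "are we sure the classes fully
  partition the space?" asked again one level down, and answered by `decide`-free case analysis.
* §2 The conjectures `X3Sharp`, `X3SharpM`, `X3SharpGord`, `X3SharpTprime`, `X3SharpW` and
  `x3Sharp_iff` (X3♯ ⇔ the conjunction of its four sub-statements — so a referee may attack them
  separately without losing or double-counting a pair); `X4Sharp`, `X4SharpThree`,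
  `X4SharpUnitFree`, `X4SharpRankOne`, with `x4Sharp_surj_iff` (on surjective pairs X4♯ ⇔
  unit-free ∧ r = 1) and the LOUD remark that the non-surjective X4 pairs (census: 96 ‖ 49 of
  4906 ‖ 1337, images 3Nn/3Ns/5Ns/5Nn/5S4/7Ns) are addressed by NONE of the three printed X4♯
  sub-statements — they remain typed (`Typed.X4.MissingInputAt`) and nothing else.
* §3 What the conjectures buy: `bsdp_of_x3Sharp`, `bsdp_of_x4Sharp` (each sharpened conjecture,
  with Gross–Zagier–Kolyvagin, gives Miller's `BSD(E,p)` on its class — via the typed class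
  theorems `Typed.X3/X4.bsdp_of_missingInputAt`), and the rank-`0` reading at a `p`-unit
  analytic `Ш` (there the conjecture is the single descent bit `Ш(E)[p] = 0`: tree theorem
  `Typed.missingPPartAt_iff_noPTorsion_of_shaAn_unit`, cited, not restated).
The partial THEOREMS toward X4♯ (Kim 2026 Thm. 1.8 at an additive prime: the upper-bound
inequality in rank `0` at `p ≥ 5`) are in the sibling file `Additive/X4RankZeroUpperBound.lean`.

References: SHARPENED-CONJECTURES.md v3.2 §3–§4 (cell HOME, `b2b-bsdres-hyp/hyp/`);
RESIDUAL-CASES.md §a.2 (classes X3, X4); D. Delbourgo, Compositio Math. 113 (1998) 123–154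
(hypotheses (G) p. 130, (M) p. 133, Thms. 1–3, Prop. 4, Main Conjecture p. 151 — locators as read
in RESIDUAL-CASES (a-S8) S44 and SHARPENED §3; the two settings of `SubGord`, `SubM`); C.-H. Kim, Amer. J.
Math. 148 (2026) Thm. 1.8 / Conj. 1.10 [Kim2022StructureSelmer]; Miller 2011 Def. 1.1 [Miller2011LMS].
-/

noncomputable section

open scoped Classical

open WeierstrassCurve IsDedekindDomain Literature.NumberTheory.EllipticCurves
  Literature.NumberTheory.EllipticCurves.ModularForms
  Literature.NumberTheory.EllipticCurves.Rank1Residual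
  Literature.NumberTheory.EllipticCurves.Rank1Residual.Typed

namespace Summit.BirchSwinnertonDyer.Rank1Residual.Additive

/-! ## §1 The census sub-types of an additive prime -/

section SubTypes

variable (W : WeierstrassCurve ℚ) [W.IsElliptic] [W.IsGloballyMinimal] (p : ℕ) [Fact p.Prime]

/-- The finite place of `ℤ` under the rational prime `p` (Mathlib's
`Rat.HeightOneSpectrum.primesEquiv : HeightOneSpectrum ℤ ≃ Nat.Primes`). [folklore] -/
def placeOf : HeightOneSpectrum ℤ :=
  (Rat.HeightOneSpectrum.primesEquiv (R := ℤ)).symm ⟨p, Fact.out⟩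

/-- `f_p(E)`: the conductor exponent of `E/ℚ` at `p` (tree `WeierstrassCurve.conductorExponent`,
Ogg's formula, file `DiophantineGeometry/Conductor`), at the place `placeOf p`. Census bit
`v_p(N)`. [folklore] -/
def condExp : ℕ := W.conductorExponent (placeOf p)

/-- **(M) potentially multiplicative**: `v_p(j(E)) < 0` (census engine A: "potentially
multiplicative ⇔ `v_p(j) < 0`"; Delbourgo 1998 hypothesis (M), p. 133; for an additive odd `p`
this is Kodaira type `I_n^*`, `n ≥ 1`, a ramified quadratic twist of a Tate curve). [folklore] -/
def PotMult : Prop := padicValRat p W.j < 0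

/-- **"tame" in the census sense**: `f_p(E) = 2` (engine A: "tame ⇔ `v_p(N) = 2`"; automatic for
an additive `p ≥ 5`, Silverman ATAEC IV.10.4; at `p = 3` it excludes the wild conductors
`v₃(N) ∈ {3, 4, 5}`). [folklore] -/
def CondExpTwo : Prop := condExp W p = 2

/-- **`e`**, the census's semistability index at a potentially good `p`:
`e = 12 / gcd(12, v_p(Δ_min))` (engine A; for `p ≥ 5` this is the order of the image of inertia,
Serre–Tate / Kraus; the census checked it two-engine against Tate's algorithm — Kodaira
`I₀* ↦ 2`, `III/III* ↦ 4`, `IV/IV* ↦ 3`, `II/II* ↦ 6` — on all 746 tame potentially good X3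
pairs). Junk (but harmless) at a potentially multiplicative or wild `p`, where no sub-statement
reads it. [folklore] -/
def semistabilityIndex : ℕ := 12 / Nat.gcd 12 (padicValInt p W.minimalDiscriminantInt)

/-- Census cell **(M)**: potentially multiplicative (SHARPENED §3: 517 ‖ 298 X3 pairs). [folklore] -/
def SubM : Prop := PotMult W p

/-- Census cell **(G-ord)**: not potentially multiplicative, `f_p = 2`, and `e ∣ p − 1` — Delbourgo's
hypothesis (G) (potentially good reduction attained over a subfield of `ℚ_p(μ_p)`); with a
rational `p`-isogeny the reduction over that field is then ORDINARY (census: 334 ‖ 191 X3 pairs,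
supersingular 0 ‖ 0). [folklore] -/
def SubGord : Prop := ¬ PotMult W p ∧ CondExpTwo W p ∧ semistabilityIndex W p ∣ p - 1

/-- Census cell **(t′)**: not potentially multiplicative, `f_p = 2`, and `e ∤ p − 1` (so `e ∣ p + 1`:
potentially good SUPERSINGULAR over the tame semistabilising field; 412 ‖ 210 X3 pairs; nothing
is formulated in print here). [folklore] -/
def SubTprime : Prop := ¬ PotMult W p ∧ CondExpTwo W p ∧ ¬ semistabilityIndex W p ∣ p - 1

/-- Census cell **(w)**: not potentially multiplicative and `f_p ≠ 2` — for an additive odd `p` this is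
the WILD case `p = 3`, `v₃(N) ∈ {3, 4, 5}` (1129 ‖ 584 X3 pairs, all potentially supersingular).
[folklore] -/
def SubW : Prop := ¬ PotMult W p ∧ ¬ CondExpTwo W p

/-- **The four census cells cover every pair** (propositional: (M) ∨ ¬(M) ∧ (f = 2 ∧ (e ∣ p−1 ∨ e ∤ p−1) ∨ f ≠ 2)).
The sub-class split of X3♯ loses no pair. [folklore] -/
theorem sub_exhaustive : SubM W p ∨ SubGord W p ∨ SubTprime W p ∨ SubW W p := by
  unfold SubM SubGord SubTprime SubW
  tauto

/-- The cells are pairwise disjoint: (M) meets none of the other three. [folklore] -/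
theorem subM_disjoint : SubM W p → ¬ SubGord W p ∧ ¬ SubTprime W p ∧ ¬ SubW W p := by
  unfold SubM SubGord SubTprime SubW
  tauto

/-- The cells are pairwise disjoint: (G-ord), (t′), (w) are mutually exclusive. [folklore] -/
theorem subGord_subTprime_subW_disjoint :
    (SubGord W p → ¬ SubTprime W p ∧ ¬ SubW W p) ∧ (SubTprime W p → ¬ SubW W p) := by
  unfold SubGord SubTprime SubW
  tauto

end SubTypes

/-! ## §2 The sharpened conjectures (data-suggested; `Prop`s, nothing asserted) -/

/-- **Conjecture X3♯** (SHARPENED-CONJECTURES.md v3.2 §3, data-suggested, NOT in print): "For every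
`E/ℚ` of analytic rank `≤ 1` and every odd prime `p` of ADDITIVE reduction at which `E` admits a
rational `p`-isogeny, `ord_p #Ш(E) = ord_p #Ш_an(E)`." In the cell's currency: on every pair of
class X3 (`Red W p ∧ Addv W p`) with `p ≠ 2` and `r_an ≤ 1`, the typed output
`MissingPPartAt W p`. Data range `N < 2·10⁴` (2392 ‖ 1283 pairs, 0 inconsistent); no published or
announced theorem reaches any pair. An OPEN PROBLEM stated as a `Prop`; nothing asserted. [folklore] -/
@[conjecture] def X3Sharp : Prop :=
  ∀ (W : WeierstrassCurve ℚ) [W.IsElliptic] [W.IsGloballyMinimal] (p : ℕ) [Fact p.Prime],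
    W.analyticRank ≤ 1 → p ≠ 2 → ClassX3 W p → MissingPPartAt W p

/-- **X3♯(M)**: X3♯ restricted to the census cell (M), tame potentially multiplicative (517 ‖ 298
pairs) — Delbourgo's setting (M), where the `p`-adic measure exists (Delbourgo 1998 Thm. 2), the
rank-`0` algebraic leading term is in print (Thm. 3 / Prop. 4) and a main conjecture is FORMULATED
(p. 151) but open. Nothing asserted. [folklore] -/
@[conjecture] def X3SharpM : Prop :=
  ∀ (W : WeierstrassCurve ℚ) [W.IsElliptic] [W.IsGloballyMinimal] (p : ℕ) [Fact p.Prime],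
    W.analyticRank ≤ 1 → p ≠ 2 → ClassX3 W p → SubM W p → MissingPPartAt W p

/-- **X3♯(G-ord)**: X3♯ restricted to the census cell (G-ord), tame, `e ∣ p − 1`, potentially good
ordinary (334 ‖ 191 pairs) — Delbourgo's setting (G) (Thm. 1, Thm. 3 / Prop. 4 at rank `0`, Main
Conjecture p. 151 open). Nothing asserted. [folklore] -/
@[conjecture] def X3SharpGord : Prop :=
  ∀ (W : WeierstrassCurve ℚ) [W.IsElliptic] [W.IsGloballyMinimal] (p : ℕ) [Fact p.Prime],
    W.analyticRank ≤ 1 → p ≠ 2 → ClassX3 W p → SubGord W p → MissingPPartAt W p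

/-- **X3♯(t′)**: X3♯ restricted to the census cell (t′), tame with `e ∤ p − 1`, potentially
supersingular (412 ‖ 210 pairs) — nothing is formulated in print. Nothing asserted. [folklore] -/
@[conjecture] def X3SharpTprime : Prop :=
  ∀ (W : WeierstrassCurve ℚ) [W.IsElliptic] [W.IsGloballyMinimal] (p : ℕ) [Fact p.Prime],
    W.analyticRank ≤ 1 → p ≠ 2 → ClassX3 W p → SubTprime W p → MissingPPartAt W p

/-- **X3♯(w)**: X3♯ restricted to the census cell (w), wild (`p = 3`, `v₃(N) ∈ {3,4,5}`; 1129 ‖ 584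
pairs) — nothing is formulated in print. Nothing asserted. [folklore] -/
@[conjecture] def X3SharpW : Prop :=
  ∀ (W : WeierstrassCurve ℚ) [W.IsElliptic] [W.IsGloballyMinimal] (p : ℕ) [Fact p.Prime],
    W.analyticRank ≤ 1 → p ≠ 2 → ClassX3 W p → SubW W p → MissingPPartAt W p

/-- **X3♯ is exactly the conjunction of its four census sub-statements** (by `sub_exhaustive`): a
referee may attack (M), (G-ord), (t′), (w) separately; no pair is lost and none is counted twice.
[folklore] -/
theorem x3Sharp_iff : X3Sharp ↔ X3SharpM ∧ X3SharpGord ∧ X3SharpTprime ∧ X3SharpW := by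
  constructor
  · intro h
    exact ⟨fun W _ _ p _ hr hp hX _ => h W p hr hp hX, fun W _ _ p _ hr hp hX _ => h W p hr hp hX,
      fun W _ _ p _ hr hp hX _ => h W p hr hp hX, fun W _ _ p _ hr hp hX _ => h W p hr hp hX⟩
  · rintro ⟨hM, hG, hT, hW⟩ W _ _ p _ hr hp hX
    rcases sub_exhaustive W p with h | h | h | h
    · exact hM W p hr hp hX h
    · exact hG W p hr hp hX h
    · exact hT W p hr hp hX h
    · exact hW W p hr hp hX h

/-- **Conjecture X4♯** (the class-wide statement for X4, RESIDUAL-CASES §a.2 / CLASSES.md: "for every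
`E/ℚ` of analytic rank `≤ 1` and every odd additive `p` with `E[p]` irreducible,
`ord_p #Ш(E) = ord_p #Ш_an(E)`"); SHARPENED §4 prints it as the three sub-statements below, ALL of
which assume `ρ̄_{E,p}` surjective — see `x4Sharp_surj_iff` and the remark after it for the
non-surjective remainder. Data range `N < 2·10⁴` (4906 ‖ 1337 pairs). OPEN; nothing asserted. [folklore] -/
@[conjecture] def X4Sharp : Prop :=
  ∀ (W : WeierstrassCurve ℚ) [W.IsElliptic] [W.IsGloballyMinimal] (p : ℕ) [Fact p.Prime],
    W.analyticRank ≤ 1 → ClassX4 W p → MissingPPartAt W p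

/-- **Conjecture X4♯(unit-free)** (SHARPENED §4, data-suggested): "For `E/ℚ` of analytic rank `0`,
`p ≥ 3` additive, `ρ̄_{E,p}` surjective: `ord_p #Ш(E) = ord_p #Ш_an(E)` also when
`p ∣ Tam(E)·#Ш_an(E)` — i.e. in Kim's formula `∂^{(∞)}(δ̃) = ord_p Tam(E)`" (Kim 2026 Conj. 1.10 at
an additive prime). Supporting rows 522 ‖ 133 beyond the 2392 ‖ 660 unit rows. For `p ≥ 5` and a
Manin constant prime to `p` the UPPER inequality `ord_p #Ш ≤ ord_p #Ш_an + ord_p Tam` is a theorem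
(Kim 2026 Thm. 1.8 (6); sibling file `X4RankZeroUpperBound`); the equality is open. Nothing
asserted. [folklore] -/
@[conjecture] def X4SharpUnitFree : Prop :=
  ∀ (W : WeierstrassCurve ℚ) [W.IsElliptic] [W.IsGloballyMinimal] (p : ℕ) [Fact p.Prime],
    W.analyticRank = 0 → ClassX4 W p → Surj W p → MissingPPartAt W p

/-- **Conjecture X4♯(r = 1)** (SHARPENED §4, data-suggested): "For `E/ℚ` of analytic rank `1` and
`p ≥ 3` additive with `ρ̄_{E,p}` surjective, `ord_p #Ш(E) = ord_p #Ш_an(E)`; in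
Gross–Zagier–Kolyvagin terms, `ord_p I_K` equals its BSD-predicted value on every Heegner field."
Supporting rows 367 ‖ 105 (`#Ш_an` a `p`-unit on all of them, so the predicted statement is
`Ш(E)[p] = 0`; the lane certifies `p ∣ I_K` on every one). Per pair it follows from ONE unit
Kurihara number at a Kolyvagin prime (Kim 2026 Thm. 1.8 (6), tree fact
`Kim2022_rankOne_card_sha_eq_one_of_kuriharaNumber_ne_zero_of_maninConstant`, `p ≥ 5`); class-wide
it is open (Kim Cor. 1.6 covers `r = 1` only at a semi-stable `p`). Nothing asserted. [folklore] -/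
@[conjecture] def X4SharpRankOne : Prop :=
  ∀ (W : WeierstrassCurve ℚ) [W.IsElliptic] [W.IsGloballyMinimal] (p : ℕ) [Fact p.Prime],
    W.analyticRank = 1 → ClassX4 W p → Surj W p → MissingPPartAt W p

/-- **Conjecture X4♯(3)** (SHARPENED §4, data-suggested): "Kim 2026 Thm. 1.8 remains valid at
`p = 3`: for `E/ℚ` with analytic rank `0`, additive reduction at `3`, `ρ̄_{E,3}` surjective (and
Manin constant prime to `3`), `ord₃ #Ш(E) ≤ ord₃(#Ш_an(E)·Tam(E))`; in particular `BSD₃(E)` holds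
whenever `3 ∤ Tam(E)·#Ш_an(E)`" — the largest single block of the residue (1582 ‖ 417 pairs, 62.9 %
of the X4 core, where Kim's hypothesis `p ≥ 5` binds ALONE). Stated as the upper-bound inequality
with `#Ш_an = q ∈ ℚ`, for every modular parametrisation datum `D` of `W` whose Manin constant is
prime to `3`. The "in particular" is `bsdp_of_x4SharpThree` (sibling file). Nothing asserted. [folklore] -/
@[conjecture] def X4SharpThree : Prop :=
  ∀ (W : WeierstrassCurve ℚ) [W.IsElliptic] [W.IsGloballyMinimal],
    W.analyticRank = 0 → ClassX4 W 3 → Surj W 3 →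
    ∀ {N : ℕ} [NeZero N] (D : ModularParametrizationData W N), ¬ (3 : ℤ) ∣ D.maninConstant →
    ∃ q : ℚ, shaAn W = (q : ℂ) ∧
      (padicValNat 3 W.shaOrder : ℤ) ≤ padicValRat 3 q + padicValNat 3 W.tamagawaProduct

/-- **On the surjective pairs, X4♯ is exactly X4♯(unit-free) ∧ X4♯(r = 1)** (rank `≤ 1` splits as
`0 ∨ 1`). [folklore] -/
theorem x4Sharp_surj_iff :
    (∀ (W : WeierstrassCurve ℚ) [W.IsElliptic] [W.IsGloballyMinimal] (p : ℕ) [Fact p.Prime],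
      W.analyticRank ≤ 1 → ClassX4 W p → Surj W p → MissingPPartAt W p) ↔
    X4SharpUnitFree ∧ X4SharpRankOne := by
  constructor
  · intro h
    exact ⟨fun W _ _ p _ hr hX hs => h W p (by omega) hX hs,
      fun W _ _ p _ hr hX hs => h W p (by omega) hX hs⟩
  · rintro ⟨h0, h1⟩ W _ _ p _ hr hX hs
    rcases Nat.le_one_iff_eq_zero_or_eq_one.mp hr with h | h
    · exact h0 W p h hX hs
    · exact h1 W p h hX hs

/-- **X4♯ implies its two surjective sub-statements** — and NOT conversely: the printed X4♯
sub-statements say nothing about the X4 pairs with `ρ̄_{E,p}` irreducible but NOT surjective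
(census: 96 ‖ 49 pairs, images 3Nn/3Ns/5Ns/5Nn/5S4/7Ns — 43 ‖ 22 in rank `0`, 53 ‖ 27 in rank `1`),
which stay TYPED (`Typed.X4.MissingInputAt`) with no sharpened conjecture of their own. Said
loudly here so that no reader counts them as addressed. [folklore] -/
theorem x4SharpUnitFree_and_rankOne_of_x4Sharp (h : X4Sharp) : X4SharpUnitFree ∧ X4SharpRankOne :=
  x4Sharp_surj_iff.mp fun W _ _ p _ hr hX _ => h W p hr hX

/-! ## §3 What the conjectures buy (bookkeeping against the typed class theorems) -/

section Consequences

variable (W : WeierstrassCurve ℚ) [W.IsElliptic] [W.IsGloballyMinimal] (p : ℕ) [Fact p.Prime]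

/-- X3♯ delivers the typed missing input of class X3 at every odd pair. [folklore] -/
theorem x3MissingInputAt_of_x3Sharp (h : X3Sharp) (hr : W.analyticRank ≤ 1) (hp : p ≠ 2)
    (hX : ClassX3 W p) : X3.MissingInputAt W p :=
  h W p hr hp hX

/-- **X3♯ ⇒ `BSD(E,p)` on class X3 (odd `p`, `r_an ≤ 1`)**, granted Gross–Zagier–Kolyvagin (`hGZK`,
tree fact `rank_eq_analyticRank_of_analyticRank_le_one`): the sharpened conjecture is exactly what
the typed class theorem `Typed.X3.bsdp_of_missingInputAt` consumes. [cite: Miller2011LMS, §1 and Def. 1.1] -/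
theorem bsdp_of_x3Sharp (h : X3Sharp) (hGZK : rank_eq_analyticRank_of_analyticRank_le_one)
    (hr : W.analyticRank ≤ 1) (hp : p ≠ 2) (hX : ClassX3 W p) : BSDp W p :=
  X3.bsdp_of_missingInputAt hGZK W p hr hX (h W p hr hp hX)

/-- **X4♯ ⇒ `BSD(E,p)` on class X4 (`r_an ≤ 1`)**, granted Gross–Zagier–Kolyvagin.
[cite: Miller2011LMS, §1 and Def. 1.1] -/
theorem bsdp_of_x4Sharp (h : X4Sharp) (hGZK : rank_eq_analyticRank_of_analyticRank_le_one)
    (hr : W.analyticRank ≤ 1) (hX : ClassX4 W p) : BSDp W p :=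
  X4.bsdp_of_missingInputAt hGZK W p hr hX (h W p hr hX)

/-- **X4♯(unit-free) ∧ X4♯(r = 1) ⇒ `BSD(E,p)` on the SURJECTIVE part of class X4 (`r_an ≤ 1`)**,
granted Gross–Zagier–Kolyvagin. [cite: Miller2011LMS, §1 and Def. 1.1] -/
theorem bsdp_of_x4SharpUnitFree_of_x4SharpRankOne (h0 : X4SharpUnitFree) (h1 : X4SharpRankOne)
    (hGZK : rank_eq_analyticRank_of_analyticRank_le_one) (hr : W.analyticRank ≤ 1)
    (hX : ClassX4 W p) (hs : Surj W p) : BSDp W p :=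
  X4.bsdp_of_missingInputAt hGZK W p hr hX (x4Sharp_surj_iff.mpr ⟨h0, h1⟩ W p hr hX hs)

/- The rank-`0` reading of X3♯ / X4♯ at a `p`-unit analytic `Ш` (SHARPENED §3: "in the rank-0 part the
predicted statement is `Ш(E′)[p^∞] = 0` … on all but 4 ‖ 1 pairs"; §4: `#Ш_an(E) = 1` on every X4♯(3)
row): for finite `Ш` and `#Ш_an = q` with `ord_p q = 0`, the typed output at `(E, p)` IS the single descent
bit `Ш(E)[p] = 0` — this is the tree theorem `Typed.missingPPartAt_iff_noPTorsion_of_shaAn_unit`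
(`Typed/KolyvaginCertificate.lean`), not restated here. On those rows each conjecture is a class-wide
VANISHING statement, testable per pair by a `p`-(isogeny) descent (sha seats). -/

end Consequences

/-! ## §4 (appended, gen 0 part 2) The (G-ord) cell split by the semistability index: `e = 2` versus `e ∈ {3, 4, 6}`

Recount from the hyp seat's `hyp_bits.tsv` (engine-A bits, N < 2·10⁴): of the 334 X3 pairs in (G-ord), **301 have
`e = 2`** (Kodaira `I₀*`: `p = 3`: 270, `p = 5`: 26, `p = 7`: 5) and 33 have `e ∈ {3, 4, 6}` (`e = 4` at `p = 5`: 25;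
`e ∈ {3, 6}` at `p = 7`: 8). The two have different theorem portfolios (cell REPAIR-CENSUS V9 / V10): for `e = 2`
the curve is the quadratic twist `E = E♭ ⊗ χ_{p*}` of a curve `E♭` with GOOD ORDINARY reduction at `p` and a rational
`p`-isogeny (an X1/C6/C7-type pair), so X3♯ there is a statement about the ODD QUADRATIC BRANCH `ω^{(p−1)/2}` of the
cyclotomic Iwasawa theory of `E♭` (where Wuthrich 2014 Thm. 16 already gives one divisibility); for `e ∈ {3,4,6}`
only a companion form `f_E ⊗ ψ̄` with nebentypus is available. Likewise the (M) cell is the multiplicative-twist case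
`E = E♭ ⊗ χ_{p*}`, `E♭` multiplicative Eisenstein at `p`. Definitions + propositional bookkeeping only; nothing asserted. -/

section GordSplit

variable (W : WeierstrassCurve ℚ) [W.IsElliptic] [W.IsGloballyMinimal] (p : ℕ) [Fact p.Prime]

/-- Census cell **(G-ord, e = 2)**: (G-ord) with semistability index `e = 2` — Kodaira type `I₀*` at `p`, i.e. `E` is the
quadratic twist by `χ_{p*}` of a curve with good (ordinary, given the `p`-isogeny) reduction at `p` (301 of the 334
(G-ord) X3 pairs). [folklore] -/
def SubGordTwo : Prop := SubGord W p ∧ semistabilityIndex W p = 2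

/-- Census cell **(G-ord, e ≠ 2)**: (G-ord) with `e ∈ {3, 4, 6}` (33 X3 pairs, all at `p ∈ {5, 7}`; not a twist of an
elliptic curve with good reduction at `p` unless `j ∈ {0, 1728}`). [folklore] -/
def SubGordHigher : Prop := SubGord W p ∧ semistabilityIndex W p ≠ 2

/-- (G-ord) is the disjoint union of its `e = 2` and `e ≠ 2` parts. [folklore] -/
theorem subGord_iff_two_or_higher : SubGord W p ↔ SubGordTwo W p ∨ SubGordHigher W p := by
  unfold SubGordTwo SubGordHigher
  tauto

/-- The two parts of (G-ord) are disjoint. [folklore] -/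
theorem subGordTwo_disjoint_higher : SubGordTwo W p → ¬ SubGordHigher W p := by
  unfold SubGordTwo SubGordHigher
  tauto

/-- Census cell **"semistable twist"** = (M) ∪ (G-ord, e = 2): the 818 (517 + 301) X3 pairs at which `E` is the quadratic
twist by `χ_{p*}` of a curve `E♭` SEMISTABLE at `p` (multiplicative, resp. good ordinary) with a rational `p`-isogeny —
the domain of the research line V9 (odd quadratic branch of the cyclotomic main conjecture of `E♭`). [folklore] -/
def SubSemistableTwist : Prop := SubM W p ∨ SubGordTwo W p

end GordSplit

/-- **X3♯(G-ord, e = 2)**: X3♯ restricted to the `I₀*` part of (G-ord) (301 pairs). Nothing asserted. [folklore] -/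
@[conjecture] def X3SharpGordTwo : Prop :=
  ∀ (W : WeierstrassCurve ℚ) [W.IsElliptic] [W.IsGloballyMinimal] (p : ℕ) [Fact p.Prime],
    W.analyticRank ≤ 1 → p ≠ 2 → ClassX3 W p → SubGordTwo W p → MissingPPartAt W p

/-- **X3♯(G-ord, e ∈ {3,4,6})**: X3♯ restricted to the `e ≠ 2` part of (G-ord) (33 pairs). Nothing asserted. [folklore] -/
@[conjecture] def X3SharpGordHigher : Prop :=
  ∀ (W : WeierstrassCurve ℚ) [W.IsElliptic] [W.IsGloballyMinimal] (p : ℕ) [Fact p.Prime],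
    W.analyticRank ≤ 1 → p ≠ 2 → ClassX3 W p → SubGordHigher W p → MissingPPartAt W p

/-- **X3♯(semistable twist)**: X3♯ restricted to (M) ∪ (G-ord, e = 2) (818 pairs) — the target of research line V9.
Nothing asserted. [folklore] -/
@[conjecture] def X3SharpSemistableTwist : Prop :=
  ∀ (W : WeierstrassCurve ℚ) [W.IsElliptic] [W.IsGloballyMinimal] (p : ℕ) [Fact p.Prime],
    W.analyticRank ≤ 1 → p ≠ 2 → ClassX3 W p → SubSemistableTwist W p → MissingPPartAt W p

/-- **X3♯(G-ord) is exactly the conjunction of its `e = 2` and `e ≠ 2` parts.** [folklore] -/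
theorem x3SharpGord_iff : X3SharpGord ↔ X3SharpGordTwo ∧ X3SharpGordHigher := by
  constructor
  · intro h
    exact ⟨fun W _ _ p _ hr hp hX hs => h W p hr hp hX hs.1, fun W _ _ p _ hr hp hX hs => h W p hr hp hX hs.1⟩
  · rintro ⟨h2, hh⟩ W _ _ p _ hr hp hX hs
    rcases (subGord_iff_two_or_higher W p).mp hs with h | h
    · exact h2 W p hr hp hX h
    · exact hh W p hr hp hX h

/-- **X3♯(semistable twist) is exactly X3♯(M) ∧ X3♯(G-ord, e = 2).** [folklore] -/
theorem x3SharpSemistableTwist_iff : X3SharpSemistableTwist ↔ X3SharpM ∧ X3SharpGordTwo := by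
  constructor
  · intro h
    exact ⟨fun W _ _ p _ hr hp hX hs => h W p hr hp hX (Or.inl hs),
      fun W _ _ p _ hr hp hX hs => h W p hr hp hX (Or.inr hs)⟩
  · rintro ⟨hM, h2⟩ W _ _ p _ hr hp hX hs
    rcases hs with h | h
    · exact hM W p hr hp hX h
    · exact h2 W p hr hp hX h

/-- **X3♯ re-split along the research lines**: X3♯ ⇔ X3♯(semistable twist) ∧ X3♯(G-ord, e ≠ 2) ∧ X3♯(t′) ∧ X3♯(w)
(818 + 33 + 412 + 1129 = 2392 pairs). [folklore] -/
theorem x3Sharp_iff_twist_split :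
    X3Sharp ↔ X3SharpSemistableTwist ∧ X3SharpGordHigher ∧ X3SharpTprime ∧ X3SharpW := by
  rw [x3Sharp_iff, x3SharpSemistableTwist_iff, x3SharpGord_iff]
  tauto

end Summit.BirchSwinnertonDyer.Rank1Residual.Additive

end
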